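import Mathlib.GroupTheory.Index
import Mathlib.Topology.Algebra.Group.Basic

/-!
# Nikolov–Segal: finite-index subgroups of topologically finitely generated profinite groups are open

N. Nikolov, D. Segal, *Finite index subgroups in profinite groups*, C. R. Math. Acad. Sci. Paris **337**
(2003) 303–308, Théorème 1.1 (full proofs: *On finitely generated profinite groups I*, Ann. of Math.
**165** (2007) 171–238, Thm 1.1): "in a topologically finitely generated profinite group every subgroup
of finite index is open" — equivalently, every homomorphism from such a group to a finite (or
profinite) group is continuous ("strong completeness").  The proof uses the classification of finite
simple groups; it is recorded here as a NAMED FACT (a `Prop`, not asserted), Mathlib-only vocabulary: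
profinite = compact, totally disconnected topological group; topologically finitely generated = some
finite subset generates a dense subgroup. [cite: NikolovSegal2003, Thm 1.1]

Consumer (cell abc-iut, layer L3): the arithmetic tempered fundamental group of [SemiAnbd] §5 — the
hypothesis "(a) `π̂₁(A)` is topologically finitely generated" of [SemiAnbd] Def 5.1 (i) yields, through
this fact, the congruence-continuity of the arithmetic outer action at finite levels
(`Literature/AnabelianGeometry/SemiGraphs/ArithOuterActionCongruenceFinite.lean`, GAP-LEDGER G-L3d2g2-1).
-/

namespace Literature.GroupTheory

universe u

/-- **Nikolov–Segal** (C. R. Acad. Sci. Paris 337 (2003) Thm 1.1; Ann. of Math. 165 (2007) Thm 1.1),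
NAMED FACT: in a topologically finitely generated profinite group — a compact, totally disconnected
topological group with a finite subset generating a dense subgroup — every subgroup of finite index is
open. [cite: NikolovSegal2003, Thm 1.1] -/
def NikolovSegalStatement : Prop :=
  ∀ (M : Type u) [Group M] [TopologicalSpace M] [IsTopologicalGroup M] [CompactSpace M]
    [TotallyDisconnectedSpace M],
    (∃ S : Finset M, Dense ((Subgroup.closure (S : Set M) : Subgroup M) : Set M)) →
      ∀ U : Subgroup M, U.FiniteIndex → IsOpen (U : Set M)

end Literature.GroupTheory
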